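import Summits.CriticalPhenomena.PercolationContinuityZ3.Theorems.PercAnnulusCrossingIICNearCriticalScheme
import Summits.CriticalPhenomena.PercolationContinuityZ3.Theorems.PercAnnulusCrossingIICNearCriticalTop
import Summits.CriticalPhenomena.PercolationContinuityZ3.Theorems.PercAnnulusCrossingIICNearCriticalScales
import Summits.CriticalPhenomena.PercolationContinuityZ3.Theorems.PercAnnulusCrossingIICAspectExistence
import HarnessLib

/-!
# Kesten's IIC scheme with an ABSTRACT junk weight, UNIFORMLY in the edge density — NEAR-CRITICAL series X (lane RSW3, p1 gen 6)

builds on p205010 (kernel theorem, internal audit signed; external expert review pending)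

Seat `prim-rsw3-p1` (gen 6).  The assembly of part XX′ (`PercAnnulusCrossingIICAspectExistence.lean`, `kestenIICExistsAt_of_setToSetQM_aspect`)
re-threaded (i) for an ABSTRACT junk weight `J p m₁ m₂` (series II–VI: the level-junk inequality is a hypothesis) and (ii) UNIFORMLY on a set
`S` of edge densities: the supersolution (`exists_kesten_supersolution_le`), the number of levels and the scales (series IX, along the predicate
"`J p a b ≤ η` for all `p ∈ S`") are chosen ONCE, so the oscillation estimate `|r_p(n) − r_p(n')| ≤ δ` holds with one threshold for all `p ∈ S`.
No `θ(p) = 0` anywhere: the junk control is the hypothesis `hJu` (instance: `J = √P(NONUNIQ)`, series VIII, by uniqueness of the infinite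
cluster).  Helper file; no definitions, no sorries; every `d ≥ 1`.
* **`iic_ratio_osc_uniform_of_junk`** — see its docstring (Basu–Sapozhnikov (2.1): uniform convergence of `P_p(E | 0 ↔ ∂ⁱⁿΛ(n))`).
References: H. Kesten, PTRF 73 (1986) Thm. (3), §2; D. Basu, A. Sapozhnikov, ECP 22 (2017) no. 26, Thm. 1.1, §2 eq. (2.1).
-/

noncomputable section

namespace Summit.CriticalPhenomena.PercolationContinuityZ3.Theorems.Crossing

open MeasureTheory Literature.Probability.Percolation Literature.Probability.LatticeModels
open Literature.Probability.Percolation.DCT16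
open Summit.CriticalPhenomena.PercolationContinuityZ3.Theorems.SurfaceTension
open scoped Literature.Probability.Percolation
open Filter Topology Literature.Probability.Percolation.DKT20

variable {d : ℕ}

/-- **Kesten's IIC scheme with an ABSTRACT junk weight, UNIFORMLY on a set `S` of edge densities.**  Data: `d ≥ 1`; `S ⊆ (0,1]`;
`ϰ > 0`; middle-sphere / outer-radius maps `σ, τ` (`m < σ m < τ m`, monotone); (A2)□(ϰ; σ, τ) at every `p ∈ S`; a junk weight `J p m₁ m₂`
satisfying the level-junk inequality at every `p ∈ S` (series II); and UNIFORM junk control: for every `η > 0`, inner index `a` and bound `B`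
some outer index `b ≥ max B 1` has `J p a b ≤ η` for all `p ∈ S`.  Conclusion: for every cylinder event `E` and `δ > 0` there is ONE `N` such
that for all `p ∈ S` and `N ≤ n' ≤ n`, `|P_p(E ∩ {0 ↔ ∂ⁱⁿΛ(n)})/π_p(n) − P_p(E ∩ {0 ↔ ∂ⁱⁿΛ(n')})/π_p(n')| ≤ δ` — the oscillation estimate of
part XX′ with the scales chosen once for all `p ∈ S` (series IX).  Proof = part XX′ (`kestenIICExistsAt_of_setToSetQM_aspect`) re-threaded.
[cite: BasuSapozhnikov2017ECP, §2 eq. (2.1) ("converges … uniformly on [p_c, p_c+δ]")] [cite: Kesten1986, Thm. (3)] -/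
theorem iic_ratio_osc_uniform_of_junk (hd : 1 ≤ d) {S : Set unitInterval} (hS0 : ∀ p ∈ S, 0 < (p : ℝ))
    {ϰ : ℝ} (hϰ : 0 < ϰ)
    {σ τ : ℕ → ℕ} (hσ : ∀ m : ℕ, 1 ≤ m → m < σ m) (hστ : ∀ m : ℕ, 1 ≤ m → σ m < τ m)
    (hσm : Monotone σ) (hτm : Monotone τ)
    (hA2 : ∀ p ∈ S, ∀ m : ℕ, 1 ≤ m → ∀ Z : Finset (Site d), box d (τ m) \ box d (m - 1) ⊆ Z →
      ∀ X : Finset (Site d), X ⊆ Z ∩ box d m → ∀ Y : Finset (Site d), Y ⊆ Z \ box d (τ m) →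
        ϰ * (bondPercolation (zdGraph d) p).real {ω | ∃ x ∈ X, ∃ s ∈ innerBoundary (zdGraph d) (box d (σ m)),
              ω ∈ openConnIn (↑Z : Set (Site d)) x s} *
          (bondPercolation (zdGraph d) p).real {ω | ∃ y ∈ Y, ∃ s ∈ innerBoundary (zdGraph d) (box d (σ m)),
              ω ∈ openConnIn (↑Z : Set (Site d)) y s} ≤
        (bondPercolation (zdGraph d) p).real {ω | ∃ x ∈ X, ∃ y ∈ Y, ω ∈ openConnIn (↑Z : Set (Site d)) x y})
    (J : unitInterval → ℕ → ℕ → ℝ)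
    (hJ : ∀ p ∈ S, ∀ ⦃m₁ m₂ n : ℕ⦄, 1 ≤ m₁ → m₁ ≤ m₂ → τ m₁ < σ m₂ → τ m₂ < n →
      ∀ ⦃H X : Finset (Site d)⦄, H ⊆ box d (m₁ - 1) → X ⊆ box d m₁ → (∀ x ∈ X, x ∉ H) →
      ϰ ^ 2 * (bondPercolation (zdGraph d) p).real
          ({ω : BondConfig (Site d) | ∃ x ∈ X, ∃ t ∈ innerBoundary (zdGraph d) (box d n),
              ω ∈ openConnIn ((↑(box d n) : Set (Site d)) \ ↑H) x t} ∩
           {ω : BondConfig (Site d) | ∃ t₁ ∈ innerBoundary (zdGraph d) (box d (σ m₁)), ∃ w₁ ∈ innerBoundary (zdGraph d) (box d (σ m₂)),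
               ∃ t₂ ∈ innerBoundary (zdGraph d) (box d (σ m₁)), ∃ w₂ ∈ innerBoundary (zdGraph d) (box d (σ m₂)),
               ω ∩ {e : Sym2 (Site d) | e ∈ (↑((box d (σ m₂)).sym2) : Set (Sym2 (Site d))) ∧
                   ¬ (∀ v ∈ e, v ∈ box d (σ m₁)) ∧ ¬ (∀ v ∈ e, v ∈ innerBoundary (zdGraph d) (box d (σ m₂)))} ∈
                 openConnIn (↑(box d (σ m₂)) : Set (Site d)) t₁ w₁ ∧
               ω ∩ {e : Sym2 (Site d) | e ∈ (↑((box d (σ m₂)).sym2) : Set (Sym2 (Site d))) ∧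
                   ¬ (∀ v ∈ e, v ∈ box d (σ m₁)) ∧ ¬ (∀ v ∈ e, v ∈ innerBoundary (zdGraph d) (box d (σ m₂)))} ∈
                 openConnIn (↑(box d (σ m₂)) : Set (Site d)) t₂ w₂ ∧
               ω ∩ {e : Sym2 (Site d) | e ∈ (↑((box d (σ m₂)).sym2) : Set (Sym2 (Site d))) ∧
                   ¬ (∀ v ∈ e, v ∈ box d (σ m₁)) ∧ ¬ (∀ v ∈ e, v ∈ innerBoundary (zdGraph d) (box d (σ m₂)))} ∉
                 openConnIn (↑(box d (σ m₂)) : Set (Site d)) w₁ w₂}) ≤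
        J p m₁ m₂ * (bondPercolation (zdGraph d) p).real {ω : BondConfig (Site d) | ∃ x ∈ X, ∃ t ∈ innerBoundary (zdGraph d) (box d n),
            ω ∈ openConnIn ((↑(box d n) : Set (Site d)) \ ↑H) x t})
    (hJu : ∀ η : ℝ, 0 < η → ∀ a B : ℕ, ∃ b : ℕ, B ≤ b ∧ 1 ≤ b ∧ ∀ p ∈ S, J p a b ≤ η)
    (F : Finset (Sym2 (Site d))) (E : Set (BondConfig (Site d))) (hEF : DeterminedBy E ↑F) {δ : ℝ} (hδ : 0 < δ) :
    ∃ N : ℕ, ∀ p ∈ S, ∀ n n' : ℕ, N ≤ n' → n' ≤ n →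
      |(bondPercolation (zdGraph d) p).real (E ∩ siteToBoundary d n) / oneArmProb d p n -
        (bondPercolation (zdGraph d) p).real (E ∩ siteToBoundary d n') / oneArmProb d p n'| ≤ δ := by
  classical
  -- (A2)□ with `ϰ₀ = min ϰ 1`, product form
  set ϰ₀ : ℝ := min ϰ 1 with hϰ₀
  have hϰ₀0 : 0 < ϰ₀ := lt_min hϰ one_pos
  have hϰ₀1 : ϰ₀ ≤ 1 := min_le_right _ _
  have hA2S : ∀ p ∈ S, ∀ m : ℕ, 1 ≤ m → ∀ Z : Finset (Site d), box d (τ m) \ box d (m - 1) ⊆ Z →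
      ∀ X : Finset (Site d), X ⊆ Z ∩ box d m → ∀ Y : Finset (Site d), Y ⊆ Z \ box d (τ m) →
        ϰ₀ * (bondPercolation (zdGraph d) p).real {ω | ∃ x ∈ X, ∃ s ∈ innerBoundary (zdGraph d) (box d (σ m)),
              ω ∈ openConnIn (↑Z : Set (Site d)) x s} *
          (bondPercolation (zdGraph d) p).real {ω | ∃ y ∈ Y, ∃ s ∈ innerBoundary (zdGraph d) (box d (σ m)),
              ω ∈ openConnIn (↑Z : Set (Site d)) y s} ≤
        (bondPercolation (zdGraph d) p).real {ω | ∃ x ∈ X, ∃ y ∈ Y, ω ∈ openConnIn (↑Z : Set (Site d)) x y} := by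
    intro p hpS m hm Z hZ X hX Y hY
    have h := hA2 p hpS m hm Z hZ X hX Y hY
    exact (mul_le_mul_of_nonneg_right (mul_le_mul_of_nonneg_right (min_le_left _ _) measureReal_nonneg) measureReal_nonneg).trans h
  obtain ⟨a₀, ha₀⟩ := exists_box_sym2_superset F
  -- supersolution, junk size, scales
  have hK : (1 : ℝ) ≤ 1 / ϰ₀ ^ 2 := by
    rw [le_div_iff₀ (by positivity), one_mul]; exact pow_le_one₀ hϰ₀0.le hϰ₀1
  obtain ⟨ε₀, hε₀0, hε₀1, L, hL, hQf⟩ := exists_kesten_supersolution_le hK (show 0 < δ / 4 by positivity)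
  set ε : ℝ := min ε₀ (δ / 8) with hε
  have hεpos : 0 < ε := lt_min hε₀0 (by positivity)
  have hεε₀ : ε ≤ ε₀ := min_le_left _ _
  have hεδ : ε ≤ δ / 8 := min_le_right _ _
  have hε1 : ε < 1 := lt_of_le_of_lt hεε₀ hε₀1
  obtain ⟨Q, hQ1, hQ, hQL⟩ := hQf ε hεpos.le hεε₀
  have hη2 : 0 < ϰ₀ ^ 2 * ε / 2 := by positivity
  obtain ⟨M1, M2, μ1, μ2, hMs, hμs, ha₀M⟩ := exists_scheme_scales_of_good hσ hστ (fun a b => ∀ p ∈ S, J p a b ≤ ϰ₀ ^ 2 * ε / 2)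
    (fun a B => hJu (ϰ₀ ^ 2 * ε / 2) hη2 a B) a₀ L
  have hμ' : ∀ l < L, τ (σ (M2 (l + 1)) + 1) + 2 ≤ σ (μ1 l) ∧ τ (μ1 l) < σ (μ2 l) ∧ μ2 l ≤ M1 l :=
    fun l hl => ⟨(hμs l hl).1, (hμs l hl).2.1, (hμs l hl).2.2.1⟩
  have hmono : ∀ l ≤ L, M2 l ≤ M2 0 := by
    intro l hl
    induction l with
    | zero => exact le_rfl
    | succ l ih =>
      obtain ⟨h1, h2, h3, -⟩ := hμs l (by omega)
      obtain ⟨h4, h45, h5, -⟩ := hMs l (by omega)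
      obtain ⟨h4', h45', h5', -⟩ := hMs (l + 1) (by omega)
      have a4 := hσ (M2 (l + 1)) (by omega)
      have a5 := hσ (σ (M2 (l + 1)) + 1) (by omega)
      have a6 := hστ (σ (M2 (l + 1)) + 1) (by omega)
      have a7 : σ (M2 (l + 1)) + 1 < μ1 l := hσm.reflect_lt (by omega)
      have a8 := hστ (μ1 l) (by omega)
      have a9 : μ1 l < μ2 l := hσm.reflect_lt (by omega)
      have : M2 (l + 1) ≤ M2 l := by omega
      exact this.trans (ih (by omega))
  -- `1 ≤ Q L`
  have hQge : ∀ l, 1 ≤ l → 1 ≤ Q l := by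
    intro l hl
    induction l with
    | zero => omega
    | succ l ih =>
      rcases Nat.eq_zero_or_pos l with rfl | hl0
      · have h1e : (1 : ℝ) ≤ 1 / (1 - ε) ^ 2 := by
          rw [le_div_iff₀ (by nlinarith), one_mul]; nlinarith
        have hx : (0 : ℝ) ≤ 1 / ϰ₀ ^ 2 := by positivity
        have he : (1 - ε) ^ 2 ≤ 1 := by nlinarith
        calc (1 : ℝ) ≤ 1 / ϰ₀ ^ 2 := hK
          _ ≤ 1 / ϰ₀ ^ 2 / (1 - ε) ^ 2 := by
              rw [le_div_iff₀ (by nlinarith)]; nlinarith [mul_le_mul_of_nonneg_left he hx]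
          _ ≤ Q 1 := hQ1
      · have ih' := ih hl0
        have hstep := hQ l hl0
        have hKinv : 1 / (1 / ϰ₀ ^ 2) = ϰ₀ ^ 2 := by rw [one_div_one_div]
        rw [hKinv] at hstep
        have hϰ2 : ϰ₀ ^ 2 ≤ 1 := pow_le_one₀ hϰ₀0.le hϰ₀1
        have hnum : 1 ≤ ϰ₀ ^ 2 + (1 - ϰ₀ ^ 2) * Q l := by nlinarith
        have hden : 0 < (1 - ε) ^ 2 := by nlinarith
        have hx0 : 0 ≤ ϰ₀ ^ 2 + (1 - ϰ₀ ^ 2) * Q l := by linarith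
        have he : (1 - ε) ^ 2 ≤ 1 := by nlinarith
        have : ϰ₀ ^ 2 + (1 - ϰ₀ ^ 2) * Q l ≤ (ϰ₀ ^ 2 + (1 - ϰ₀ ^ 2) * Q l) / (1 - ε) ^ 2 := by
          rw [le_div_iff₀ hden]; nlinarith [mul_le_mul_of_nonneg_left he hx0]
        linarith
  refine ⟨τ (M2 0) + 1, fun p hpS n n' hNn' hnn' => ?_⟩
  have hp : 0 < (p : ℝ) := hS0 p hpS
  set μ := bondPercolation (zdGraph d) p with hμ
  have hA2' := hA2S p hpS
  have hJ' : ∀ ⦃m₁ m₂ n : ℕ⦄, 1 ≤ m₁ → m₁ ≤ m₂ → τ m₁ < σ m₂ → τ m₂ < n →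
      ∀ ⦃H X : Finset (Site d)⦄, H ⊆ box d (m₁ - 1) → X ⊆ box d m₁ → (∀ x ∈ X, x ∉ H) →
      ϰ₀ ^ 2 * (bondPercolation (zdGraph d) p).real
          ({ω : BondConfig (Site d) | ∃ x ∈ X, ∃ t ∈ innerBoundary (zdGraph d) (box d n),
              ω ∈ openConnIn ((↑(box d n) : Set (Site d)) \ ↑H) x t} ∩
           {ω : BondConfig (Site d) | ∃ t₁ ∈ innerBoundary (zdGraph d) (box d (σ m₁)), ∃ w₁ ∈ innerBoundary (zdGraph d) (box d (σ m₂)),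
               ∃ t₂ ∈ innerBoundary (zdGraph d) (box d (σ m₁)), ∃ w₂ ∈ innerBoundary (zdGraph d) (box d (σ m₂)),
               ω ∩ {e : Sym2 (Site d) | e ∈ (↑((box d (σ m₂)).sym2) : Set (Sym2 (Site d))) ∧
                   ¬ (∀ v ∈ e, v ∈ box d (σ m₁)) ∧ ¬ (∀ v ∈ e, v ∈ innerBoundary (zdGraph d) (box d (σ m₂)))} ∈
                 openConnIn (↑(box d (σ m₂)) : Set (Site d)) t₁ w₁ ∧
               ω ∩ {e : Sym2 (Site d) | e ∈ (↑((box d (σ m₂)).sym2) : Set (Sym2 (Site d))) ∧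
                   ¬ (∀ v ∈ e, v ∈ box d (σ m₁)) ∧ ¬ (∀ v ∈ e, v ∈ innerBoundary (zdGraph d) (box d (σ m₂)))} ∈
                 openConnIn (↑(box d (σ m₂)) : Set (Site d)) t₂ w₂ ∧
               ω ∩ {e : Sym2 (Site d) | e ∈ (↑((box d (σ m₂)).sym2) : Set (Sym2 (Site d))) ∧
                   ¬ (∀ v ∈ e, v ∈ box d (σ m₁)) ∧ ¬ (∀ v ∈ e, v ∈ innerBoundary (zdGraph d) (box d (σ m₂)))} ∉
                 openConnIn (↑(box d (σ m₂)) : Set (Site d)) w₁ w₂}) ≤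
        J p m₁ m₂ * (bondPercolation (zdGraph d) p).real {ω : BondConfig (Site d) | ∃ x ∈ X, ∃ t ∈ innerBoundary (zdGraph d) (box d n),
            ω ∈ openConnIn ((↑(box d n) : Set (Site d)) \ ↑H) x t} := by
    intro m₁ m₂ n h1 h2 h3 h4 H X hH hX hXH
    have hϰϰ : ϰ₀ ^ 2 ≤ ϰ ^ 2 := pow_le_pow_left₀ hϰ₀0.le (min_le_left _ _) 2
    exact (mul_le_mul_of_nonneg_right hϰϰ measureReal_nonneg).trans (hJ p hpS h1 h2 h3 h4 hH hX hXH)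
  have hjunk' : ∀ l < L, J p (μ1 l) (μ2 l) + J p (M1 l) (M2 l) ≤ ϰ₀ ^ 2 * ε := by
    intro l hl
    have h1 := (hμs l hl).2.2.2 p hpS
    have h2 := (hMs l hl.le).2.2.2 p hpS
    linarith
  -- the main estimate
  have main : ∀ n n' : ℕ, τ (M2 0) < n' → n' ≤ n →
      |μ.real (E ∩ siteToBoundary d n) / oneArmProb d p n - μ.real (E ∩ siteToBoundary d n') / oneArmProb d p n'| ≤ δ / 2 := by
    intro n n' hn' hnn'
    have hnL : τ (M2 L) < n' := lt_of_le_of_lt (hτm (hmono L le_rfl)) hn'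
    have hM' : ∀ l ≤ L, 1 ≤ M1 l ∧ M1 l ≤ M2 l ∧ τ (M1 l) < σ (M2 l) ∧ τ (M2 l) < n' := fun l hl =>
      ⟨(hMs l hl).1, (hMs l hl).2.1, (hMs l hl).2.2.1, lt_of_le_of_lt (hτm (hmono l hl)) hn'⟩
    obtain ⟨hML1, hML12, hML2, -⟩ := hM' L le_rfl
    have aL1 := hσ (M2 L) (by omega)
    have aL2 := hστ (M2 L) (by omega)
    have hE' : DeterminedBy E (↑((box d (σ (M1 L))).sym2) : Set (Sym2 (Site d))) :=
      hEF.mono (Finset.coe_subset.2 (ha₀.trans (Finset.sym2_mono (box_mono d ha₀M))))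
    have hU' : DeterminedBy (Set.univ : Set (BondConfig (Site d))) (↑((box d (σ (M1 L))).sym2) : Set (Sym2 (Site d))) := by
      rw [determinedBy_iff]; intro ω ω' _; simp
    obtain ⟨hSE1, hSE2⟩ := top_two_sided_junk p hϰ₀0 hσ hστ (J p) hJ' hML1 hML12 hML2 (by omega : τ (M2 L) < n) hE' subset_rfl
    obtain ⟨hSE1', hSE2'⟩ := top_two_sided_junk p hϰ₀0 hσ hστ (J p) hJ' hML1 hML12 hML2 hnL hE' subset_rfl
    obtain ⟨hSU1, hSU2⟩ := top_two_sided_junk p hϰ₀0 hσ hστ (J p) hJ' hML1 hML12 hML2 (by omega : τ (M2 L) < n) hU' subset_rfl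
    obtain ⟨hSU1', hSU2'⟩ := top_two_sided_junk p hϰ₀0 hσ hστ (J p) hJ' hML1 hML12 hML2 hnL hU' subset_rfl
    set 𝒟 := ((box d (σ (M2 L))).powerset.filter (fun U => box d (σ (M1 L)) ⊆ U)) ×ˢ (box d (σ (M2 L) + 1)).powerset with h𝒟
    set SEn := ∑ C ∈ 𝒟, (bondPercolation (zdGraph d) p).real (E ∩
          {ω : BondConfig (Site d) | ω ∩ (↑((box d (σ (M2 L) + 1)).sym2) : Set (Sym2 (Site d))) ∈
            explEvent (↑(box d (σ (M1 L))) : Set (Site d)) ((↑(box d (σ (M2 L))) : Set (Site d)) \ ↑(box d (σ (M1 L)))) ↑C.1 ↑C.2} ∩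
          {ω : BondConfig (Site d) | ∀ r ∈ C.2, ∀ r' ∈ C.2, ∃ v ∈ C.1, ∃ v' ∈ C.1,
            s(v, r) ∈ ω ∧ s(v', r') ∈ ω ∧ ω ∈ openConnIn ((↑C.1 : Set (Site d)) \ ↑(box d (σ (M1 L) - 1))) v v'} ∩
          {ω : BondConfig (Site d) | ∃ x ∈ ({0} : Finset (Site d)), ∃ r ∈ C.2, ∃ v ∈ C.1, ω ∈ openConnIn ((↑C.1 : Set (Site d)) \ ↑(∅ : Finset (Site d))) x v ∧ s(v, r) ∈ ω}) * (bondPercolation (zdGraph d) p).real {ω : BondConfig (Site d) | ∃ x ∈ C.2, ∃ t ∈ innerBoundary (zdGraph d) (box d n),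
            ω ∈ openConnIn ((↑(box d n) : Set (Site d)) \ ↑C.1) x t} with hSEn
    set SEn' := ∑ C ∈ 𝒟, (bondPercolation (zdGraph d) p).real (E ∩
          {ω : BondConfig (Site d) | ω ∩ (↑((box d (σ (M2 L) + 1)).sym2) : Set (Sym2 (Site d))) ∈
            explEvent (↑(box d (σ (M1 L))) : Set (Site d)) ((↑(box d (σ (M2 L))) : Set (Site d)) \ ↑(box d (σ (M1 L)))) ↑C.1 ↑C.2} ∩
          {ω : BondConfig (Site d) | ∀ r ∈ C.2, ∀ r' ∈ C.2, ∃ v ∈ C.1, ∃ v' ∈ C.1,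
            s(v, r) ∈ ω ∧ s(v', r') ∈ ω ∧ ω ∈ openConnIn ((↑C.1 : Set (Site d)) \ ↑(box d (σ (M1 L) - 1))) v v'} ∩
          {ω : BondConfig (Site d) | ∃ x ∈ ({0} : Finset (Site d)), ∃ r ∈ C.2, ∃ v ∈ C.1, ω ∈ openConnIn ((↑C.1 : Set (Site d)) \ ↑(∅ : Finset (Site d))) x v ∧ s(v, r) ∈ ω}) * (bondPercolation (zdGraph d) p).real {ω : BondConfig (Site d) | ∃ x ∈ C.2, ∃ t ∈ innerBoundary (zdGraph d) (box d n'),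
            ω ∈ openConnIn ((↑(box d n') : Set (Site d)) \ ↑C.1) x t} with hSEn'
    set SUn := ∑ C ∈ 𝒟, (bondPercolation (zdGraph d) p).real (Set.univ ∩
          {ω : BondConfig (Site d) | ω ∩ (↑((box d (σ (M2 L) + 1)).sym2) : Set (Sym2 (Site d))) ∈
            explEvent (↑(box d (σ (M1 L))) : Set (Site d)) ((↑(box d (σ (M2 L))) : Set (Site d)) \ ↑(box d (σ (M1 L)))) ↑C.1 ↑C.2} ∩
          {ω : BondConfig (Site d) | ∀ r ∈ C.2, ∀ r' ∈ C.2, ∃ v ∈ C.1, ∃ v' ∈ C.1,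
            s(v, r) ∈ ω ∧ s(v', r') ∈ ω ∧ ω ∈ openConnIn ((↑C.1 : Set (Site d)) \ ↑(box d (σ (M1 L) - 1))) v v'} ∩
          {ω : BondConfig (Site d) | ∃ x ∈ ({0} : Finset (Site d)), ∃ r ∈ C.2, ∃ v ∈ C.1, ω ∈ openConnIn ((↑C.1 : Set (Site d)) \ ↑(∅ : Finset (Site d))) x v ∧ s(v, r) ∈ ω}) * (bondPercolation (zdGraph d) p).real {ω : BondConfig (Site d) | ∃ x ∈ C.2, ∃ t ∈ innerBoundary (zdGraph d) (box d n),
            ω ∈ openConnIn ((↑(box d n) : Set (Site d)) \ ↑C.1) x t} with hSUn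
    set SUn' := ∑ C ∈ 𝒟, (bondPercolation (zdGraph d) p).real (Set.univ ∩
          {ω : BondConfig (Site d) | ω ∩ (↑((box d (σ (M2 L) + 1)).sym2) : Set (Sym2 (Site d))) ∈
            explEvent (↑(box d (σ (M1 L))) : Set (Site d)) ((↑(box d (σ (M2 L))) : Set (Site d)) \ ↑(box d (σ (M1 L)))) ↑C.1 ↑C.2} ∩
          {ω : BondConfig (Site d) | ∀ r ∈ C.2, ∀ r' ∈ C.2, ∃ v ∈ C.1, ∃ v' ∈ C.1,
            s(v, r) ∈ ω ∧ s(v', r') ∈ ω ∧ ω ∈ openConnIn ((↑C.1 : Set (Site d)) \ ↑(box d (σ (M1 L) - 1))) v v'} ∩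
          {ω : BondConfig (Site d) | ∃ x ∈ ({0} : Finset (Site d)), ∃ r ∈ C.2, ∃ v ∈ C.1, ω ∈ openConnIn ((↑C.1 : Set (Site d)) \ ↑(∅ : Finset (Site d))) x v ∧ s(v, r) ∈ ω}) * (bondPercolation (zdGraph d) p).real {ω : BondConfig (Site d) | ∃ x ∈ C.2, ∃ t ∈ innerBoundary (zdGraph d) (box d n'),
            ω ∈ openConnIn ((↑(box d n') : Set (Site d)) \ ↑C.1) x t} with hSUn'
    -- junk of the top level
    have hπn : 0 < oneArmProb d p n := oneArmProb_pos hd p hp n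
    have hπn' : 0 < oneArmProb d p n' := oneArmProb_pos hd p hp n'
    have hπeq : ∀ N : ℕ, μ.real (Set.univ ∩ siteToBoundary d N) = oneArmProb d p N := fun N => by
      rw [Set.univ_inter]; rfl
    rw [hπeq n] at hSU1 hSU2
    rw [hπeq n'] at hSU1' hSU2'
    have hη : ϰ₀⁻¹ ^ 2 * J p (M1 L) (M2 L) ≤ ε := by
      have h2 := (hMs L le_rfl).2.2.2 p hpS
      rw [inv_pow, inv_mul_le_iff₀ (by positivity : (0 : ℝ) < ϰ₀ ^ 2)]
      have : 0 ≤ ϰ₀ ^ 2 * ε := by positivity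
      linarith
    -- membership facts for the top data
    have hfacts : ∀ C ∈ 𝒟, C.1 ⊆ box d (σ (M2 L)) ∧
        (bondPercolation (zdGraph d) p).real (Set.univ ∩
          {ω : BondConfig (Site d) | ω ∩ (↑((box d (σ (M2 L) + 1)).sym2) : Set (Sym2 (Site d))) ∈
            explEvent (↑(box d (σ (M1 L))) : Set (Site d)) ((↑(box d (σ (M2 L))) : Set (Site d)) \ ↑(box d (σ (M1 L)))) ↑C.1 ↑C.2} ∩
          {ω : BondConfig (Site d) | ∀ r ∈ C.2, ∀ r' ∈ C.2, ∃ v ∈ C.1, ∃ v' ∈ C.1,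
            s(v, r) ∈ ω ∧ s(v', r') ∈ ω ∧ ω ∈ openConnIn ((↑C.1 : Set (Site d)) \ ↑(box d (σ (M1 L) - 1))) v v'} ∩
          {ω : BondConfig (Site d) | ∃ x ∈ ({0} : Finset (Site d)), ∃ r ∈ C.2, ∃ v ∈ C.1, ω ∈ openConnIn ((↑C.1 : Set (Site d)) \ ↑(∅ : Finset (Site d))) x v ∧ s(v, r) ∈ ω}) ≤ (bondPercolation (zdGraph d) p).real {ω : BondConfig (Site d) | ω ∩ (↑((box d (σ (M2 L) + 1)).sym2) : Set (Sym2 (Site d))) ∈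
            explEvent (↑(box d (σ (M1 L))) : Set (Site d)) ((↑(box d (σ (M2 L))) : Set (Site d)) \ ↑(box d (σ (M1 L)))) ↑C.1 ↑C.2} := by
      intro C hC
      rw [h𝒟, Finset.mem_product, Finset.mem_filter, Finset.mem_powerset] at hC
      exact ⟨hC.1.1, measureReal_mono (fun ω h => h.1.1.2) (measure_ne_top _ _)⟩
    have hwle : ∀ C ∈ 𝒟, (bondPercolation (zdGraph d) p).real (E ∩
          {ω : BondConfig (Site d) | ω ∩ (↑((box d (σ (M2 L) + 1)).sym2) : Set (Sym2 (Site d))) ∈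
            explEvent (↑(box d (σ (M1 L))) : Set (Site d)) ((↑(box d (σ (M2 L))) : Set (Site d)) \ ↑(box d (σ (M1 L)))) ↑C.1 ↑C.2} ∩
          {ω : BondConfig (Site d) | ∀ r ∈ C.2, ∀ r' ∈ C.2, ∃ v ∈ C.1, ∃ v' ∈ C.1,
            s(v, r) ∈ ω ∧ s(v', r') ∈ ω ∧ ω ∈ openConnIn ((↑C.1 : Set (Site d)) \ ↑(box d (σ (M1 L) - 1))) v v'} ∩
          {ω : BondConfig (Site d) | ∃ x ∈ ({0} : Finset (Site d)), ∃ r ∈ C.2, ∃ v ∈ C.1, ω ∈ openConnIn ((↑C.1 : Set (Site d)) \ ↑(∅ : Finset (Site d))) x v ∧ s(v, r) ∈ ω}) ≤ (bondPercolation (zdGraph d) p).real (Set.univ ∩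
          {ω : BondConfig (Site d) | ω ∩ (↑((box d (σ (M2 L) + 1)).sym2) : Set (Sym2 (Site d))) ∈
            explEvent (↑(box d (σ (M1 L))) : Set (Site d)) ((↑(box d (σ (M2 L))) : Set (Site d)) \ ↑(box d (σ (M1 L)))) ↑C.1 ↑C.2} ∩
          {ω : BondConfig (Site d) | ∀ r ∈ C.2, ∀ r' ∈ C.2, ∃ v ∈ C.1, ∃ v' ∈ C.1,
            s(v, r) ∈ ω ∧ s(v', r') ∈ ω ∧ ω ∈ openConnIn ((↑C.1 : Set (Site d)) \ ↑(box d (σ (M1 L) - 1))) v v'} ∩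
          {ω : BondConfig (Site d) | ∃ x ∈ ({0} : Finset (Site d)), ∃ r ∈ C.2, ∃ v ∈ C.1, ω ∈ openConnIn ((↑C.1 : Set (Site d)) \ ↑(∅ : Finset (Site d))) x v ∧ s(v, r) ∈ ω}) := fun C _ =>
      measureReal_mono (Set.inter_subset_inter_left _ (Set.inter_subset_inter_left _
        (Set.inter_subset_inter_left _ (Set.subset_univ E)))) (measure_ne_top _ _)
    -- the cross inequalities from the oscillation bound
    have hosc : ∀ C ∈ 𝒟, ∀ C' ∈ 𝒟, 0 < (bondPercolation (zdGraph d) p).real (Set.univ ∩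
          {ω : BondConfig (Site d) | ω ∩ (↑((box d (σ (M2 L) + 1)).sym2) : Set (Sym2 (Site d))) ∈
            explEvent (↑(box d (σ (M1 L))) : Set (Site d)) ((↑(box d (σ (M2 L))) : Set (Site d)) \ ↑(box d (σ (M1 L)))) ↑C.1 ↑C.2} ∩
          {ω : BondConfig (Site d) | ∀ r ∈ C.2, ∀ r' ∈ C.2, ∃ v ∈ C.1, ∃ v' ∈ C.1,
            s(v, r) ∈ ω ∧ s(v', r') ∈ ω ∧ ω ∈ openConnIn ((↑C.1 : Set (Site d)) \ ↑(box d (σ (M1 L) - 1))) v v'} ∩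
          {ω : BondConfig (Site d) | ∃ x ∈ ({0} : Finset (Site d)), ∃ r ∈ C.2, ∃ v ∈ C.1, ω ∈ openConnIn ((↑C.1 : Set (Site d)) \ ↑(∅ : Finset (Site d))) x v ∧ s(v, r) ∈ ω}) →
        0 < (bondPercolation (zdGraph d) p).real (Set.univ ∩
          {ω : BondConfig (Site d) | ω ∩ (↑((box d (σ (M2 L) + 1)).sym2) : Set (Sym2 (Site d))) ∈
            explEvent (↑(box d (σ (M1 L))) : Set (Site d)) ((↑(box d (σ (M2 L))) : Set (Site d)) \ ↑(box d (σ (M1 L)))) ↑C'.1 ↑C'.2} ∩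
          {ω : BondConfig (Site d) | ∀ r ∈ C'.2, ∀ r' ∈ C'.2, ∃ v ∈ C'.1, ∃ v' ∈ C'.1,
            s(v, r) ∈ ω ∧ s(v', r') ∈ ω ∧ ω ∈ openConnIn ((↑C'.1 : Set (Site d)) \ ↑(box d (σ (M1 L) - 1))) v v'} ∩
          {ω : BondConfig (Site d) | ∃ x ∈ ({0} : Finset (Site d)), ∃ r ∈ C'.2, ∃ v ∈ C'.1, ω ∈ openConnIn ((↑C'.1 : Set (Site d)) \ ↑(∅ : Finset (Site d))) x v ∧ s(v, r) ∈ ω}) →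
        0 < (bondPercolation (zdGraph d) p).real {ω : BondConfig (Site d) | ∃ x ∈ C.2, ∃ t ∈ innerBoundary (zdGraph d) (box d n),
            ω ∈ openConnIn ((↑(box d n) : Set (Site d)) \ ↑C.1) x t} → 0 < (bondPercolation (zdGraph d) p).real {ω : BondConfig (Site d) | ∃ x ∈ C'.2, ∃ t ∈ innerBoundary (zdGraph d) (box d n),
            ω ∈ openConnIn ((↑(box d n) : Set (Site d)) \ ↑C'.1) x t} →
        (bondPercolation (zdGraph d) p).real {ω : BondConfig (Site d) | ∃ x ∈ C.2, ∃ t ∈ innerBoundary (zdGraph d) (box d n),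
            ω ∈ openConnIn ((↑(box d n) : Set (Site d)) \ ↑C.1) x t} * (bondPercolation (zdGraph d) p).real {ω : BondConfig (Site d) | ∃ x ∈ C'.2, ∃ t ∈ innerBoundary (zdGraph d) (box d n'),
            ω ∈ openConnIn ((↑(box d n') : Set (Site d)) \ ↑C'.1) x t} ≤
          Q L * ((bondPercolation (zdGraph d) p).real {ω : BondConfig (Site d) | ∃ x ∈ C'.2, ∃ t ∈ innerBoundary (zdGraph d) (box d n),
            ω ∈ openConnIn ((↑(box d n) : Set (Site d)) \ ↑C'.1) x t} * (bondPercolation (zdGraph d) p).real {ω : BondConfig (Site d) | ∃ x ∈ C.2, ∃ t ∈ innerBoundary (zdGraph d) (box d n'),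
            ω ∈ openConnIn ((↑(box d n') : Set (Site d)) \ ↑C.1) x t}) := by
      intro C hC C' hC' hwC hwC' hγC hγC'
      exact conn_ratio_osc_le_junk p hp hϰ₀0 hϰ₀1 hσ hστ hσm hτm hA2' (J p) hJ' hL hnn' hM' hμ' hjunk' hεpos.le hε1 Q hQ1 hQ hC hC' hγC
        (lt_of_lt_of_le hwC (hfacts C hC).2) hγC' (lt_of_lt_of_le hwC' (hfacts C' hC').2)
    have htransfer : ∀ C ∈ 𝒟, 0 < (bondPercolation (zdGraph d) p).real {ω : BondConfig (Site d) | ∃ x ∈ C.2, ∃ t ∈ innerBoundary (zdGraph d) (box d n'),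
            ω ∈ openConnIn ((↑(box d n') : Set (Site d)) \ ↑C.1) x t} → 0 < (bondPercolation (zdGraph d) p).real {ω : BondConfig (Site d) | ∃ x ∈ C.2, ∃ t ∈ innerBoundary (zdGraph d) (box d n),
            ω ∈ openConnIn ((↑(box d n) : Set (Site d)) \ ↑C.1) x t} := fun C hC h =>
      real_conn_pos_of_real_conn_pos p hp (b := σ (M2 L)) (by omega) hnn' (hfacts C hC).1 h
    have hanti : ∀ C ∈ 𝒟, (bondPercolation (zdGraph d) p).real {ω : BondConfig (Site d) | ∃ x ∈ C.2, ∃ t ∈ innerBoundary (zdGraph d) (box d n),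
            ω ∈ openConnIn ((↑(box d n) : Set (Site d)) \ ↑C.1) x t} ≤ (bondPercolation (zdGraph d) p).real {ω : BondConfig (Site d) | ∃ x ∈ C.2, ∃ t ∈ innerBoundary (zdGraph d) (box d n'),
            ω ∈ openConnIn ((↑(box d n') : Set (Site d)) \ ↑C.1) x t} := by
      intro C hC
      rw [h𝒟, Finset.mem_product, Finset.mem_powerset] at hC
      exact real_conn_anti p (by omega) hnn' (hC.2.trans (box_mono d (by omega)))
    have hQ0 : 0 ≤ Q L := zero_le_one.trans (hQge L hL)
    have hx1 : SEn * SUn' ≤ Q L * (SEn' * SUn) :=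
      sum_mul_sum_le_of_osc 𝒟 (f := fun C => (bondPercolation (zdGraph d) p).real (E ∩
          {ω : BondConfig (Site d) | ω ∩ (↑((box d (σ (M2 L) + 1)).sym2) : Set (Sym2 (Site d))) ∈
            explEvent (↑(box d (σ (M1 L))) : Set (Site d)) ((↑(box d (σ (M2 L))) : Set (Site d)) \ ↑(box d (σ (M1 L)))) ↑C.1 ↑C.2} ∩
          {ω : BondConfig (Site d) | ∀ r ∈ C.2, ∀ r' ∈ C.2, ∃ v ∈ C.1, ∃ v' ∈ C.1,
            s(v, r) ∈ ω ∧ s(v', r') ∈ ω ∧ ω ∈ openConnIn ((↑C.1 : Set (Site d)) \ ↑(box d (σ (M1 L) - 1))) v v'} ∩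
          {ω : BondConfig (Site d) | ∃ x ∈ ({0} : Finset (Site d)), ∃ r ∈ C.2, ∃ v ∈ C.1, ω ∈ openConnIn ((↑C.1 : Set (Site d)) \ ↑(∅ : Finset (Site d))) x v ∧ s(v, r) ∈ ω}))
        (g := fun C => (bondPercolation (zdGraph d) p).real (Set.univ ∩
          {ω : BondConfig (Site d) | ω ∩ (↑((box d (σ (M2 L) + 1)).sym2) : Set (Sym2 (Site d))) ∈
            explEvent (↑(box d (σ (M1 L))) : Set (Site d)) ((↑(box d (σ (M2 L))) : Set (Site d)) \ ↑(box d (σ (M1 L)))) ↑C.1 ↑C.2} ∩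
          {ω : BondConfig (Site d) | ∀ r ∈ C.2, ∀ r' ∈ C.2, ∃ v ∈ C.1, ∃ v' ∈ C.1,
            s(v, r) ∈ ω ∧ s(v', r') ∈ ω ∧ ω ∈ openConnIn ((↑C.1 : Set (Site d)) \ ↑(box d (σ (M1 L) - 1))) v v'} ∩
          {ω : BondConfig (Site d) | ∃ x ∈ ({0} : Finset (Site d)), ∃ r ∈ C.2, ∃ v ∈ C.1, ω ∈ openConnIn ((↑C.1 : Set (Site d)) \ ↑(∅ : Finset (Site d))) x v ∧ s(v, r) ∈ ω}))
        (u := fun C => (bondPercolation (zdGraph d) p).real {ω : BondConfig (Site d) | ∃ x ∈ C.2, ∃ t ∈ innerBoundary (zdGraph d) (box d n),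
            ω ∈ openConnIn ((↑(box d n) : Set (Site d)) \ ↑C.1) x t})
        (v := fun C => (bondPercolation (zdGraph d) p).real {ω : BondConfig (Site d) | ∃ x ∈ C.2, ∃ t ∈ innerBoundary (zdGraph d) (box d n'),
            ω ∈ openConnIn ((↑(box d n') : Set (Site d)) \ ↑C.1) x t})
        hQ0 (fun C _ => measureReal_nonneg) hwle (fun C _ => measureReal_nonneg) (fun C _ => measureReal_nonneg)
        (fun C hC _ h => htransfer C hC h) hosc
    have hx2 : SEn' * SUn ≤ Q L * (SEn * SUn') :=
      sum_mul_sum_le_of_osc 𝒟 (f := fun C => (bondPercolation (zdGraph d) p).real (E ∩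
          {ω : BondConfig (Site d) | ω ∩ (↑((box d (σ (M2 L) + 1)).sym2) : Set (Sym2 (Site d))) ∈
            explEvent (↑(box d (σ (M1 L))) : Set (Site d)) ((↑(box d (σ (M2 L))) : Set (Site d)) \ ↑(box d (σ (M1 L)))) ↑C.1 ↑C.2} ∩
          {ω : BondConfig (Site d) | ∀ r ∈ C.2, ∀ r' ∈ C.2, ∃ v ∈ C.1, ∃ v' ∈ C.1,
            s(v, r) ∈ ω ∧ s(v', r') ∈ ω ∧ ω ∈ openConnIn ((↑C.1 : Set (Site d)) \ ↑(box d (σ (M1 L) - 1))) v v'} ∩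
          {ω : BondConfig (Site d) | ∃ x ∈ ({0} : Finset (Site d)), ∃ r ∈ C.2, ∃ v ∈ C.1, ω ∈ openConnIn ((↑C.1 : Set (Site d)) \ ↑(∅ : Finset (Site d))) x v ∧ s(v, r) ∈ ω}))
        (g := fun C => (bondPercolation (zdGraph d) p).real (Set.univ ∩
          {ω : BondConfig (Site d) | ω ∩ (↑((box d (σ (M2 L) + 1)).sym2) : Set (Sym2 (Site d))) ∈
            explEvent (↑(box d (σ (M1 L))) : Set (Site d)) ((↑(box d (σ (M2 L))) : Set (Site d)) \ ↑(box d (σ (M1 L)))) ↑C.1 ↑C.2} ∩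
          {ω : BondConfig (Site d) | ∀ r ∈ C.2, ∀ r' ∈ C.2, ∃ v ∈ C.1, ∃ v' ∈ C.1,
            s(v, r) ∈ ω ∧ s(v', r') ∈ ω ∧ ω ∈ openConnIn ((↑C.1 : Set (Site d)) \ ↑(box d (σ (M1 L) - 1))) v v'} ∩
          {ω : BondConfig (Site d) | ∃ x ∈ ({0} : Finset (Site d)), ∃ r ∈ C.2, ∃ v ∈ C.1, ω ∈ openConnIn ((↑C.1 : Set (Site d)) \ ↑(∅ : Finset (Site d))) x v ∧ s(v, r) ∈ ω}))
        (u := fun C => (bondPercolation (zdGraph d) p).real {ω : BondConfig (Site d) | ∃ x ∈ C.2, ∃ t ∈ innerBoundary (zdGraph d) (box d n'),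
            ω ∈ openConnIn ((↑(box d n') : Set (Site d)) \ ↑C.1) x t})
        (v := fun C => (bondPercolation (zdGraph d) p).real {ω : BondConfig (Site d) | ∃ x ∈ C.2, ∃ t ∈ innerBoundary (zdGraph d) (box d n),
            ω ∈ openConnIn ((↑(box d n) : Set (Site d)) \ ↑C.1) x t})
        hQ0 (fun C _ => measureReal_nonneg) hwle (fun C _ => measureReal_nonneg) (fun C _ => measureReal_nonneg)
        (fun C hC _ h => lt_of_lt_of_le h (hanti C hC))
        (fun C hC C' hC' hwC hwC' hγC hγC' => by
          have h := hosc C' hC' C hC hwC' hwC (htransfer C' hC' hγC') (htransfer C hC hγC)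
          linarith [mul_comm ((bondPercolation (zdGraph d) p).real {ω : BondConfig (Site d) | ∃ x ∈ C.2, ∃ t ∈ innerBoundary (zdGraph d) (box d n'),
            ω ∈ openConnIn ((↑(box d n') : Set (Site d)) \ ↑C.1) x t}) ((bondPercolation (zdGraph d) p).real {ω : BondConfig (Site d) | ∃ x ∈ C'.2, ∃ t ∈ innerBoundary (zdGraph d) (box d n),
            ω ∈ openConnIn ((↑(box d n) : Set (Site d)) \ ↑C'.1) x t}),
            mul_comm ((bondPercolation (zdGraph d) p).real {ω : BondConfig (Site d) | ∃ x ∈ C'.2, ∃ t ∈ innerBoundary (zdGraph d) (box d n'),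
            ω ∈ openConnIn ((↑(box d n') : Set (Site d)) \ ↑C'.1) x t}) ((bondPercolation (zdGraph d) p).real {ω : BondConfig (Site d) | ∃ x ∈ C.2, ∃ t ∈ innerBoundary (zdGraph d) (box d n),
            ω ∈ openConnIn ((↑(box d n) : Set (Site d)) \ ↑C.1) x t})])
    -- sums comparisons
    have hSS : SEn ≤ SUn := Finset.sum_le_sum fun C hC => mul_le_mul_of_nonneg_right (hwle C hC) measureReal_nonneg
    have hSS' : SEn' ≤ SUn' := Finset.sum_le_sum fun C hC => mul_le_mul_of_nonneg_right (hwle C hC) measureReal_nonneg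
    have h0S : 0 ≤ SEn := Finset.sum_nonneg fun C _ => mul_nonneg measureReal_nonneg measureReal_nonneg
    have h0S' : 0 ≤ SEn' := Finset.sum_nonneg fun C _ => mul_nonneg measureReal_nonneg measureReal_nonneg
    have hjn : ϰ₀⁻¹ ^ 2 * J p (M1 L) (M2 L) * oneArmProb d p n ≤ ε * oneArmProb d p n :=
      mul_le_mul_of_nonneg_right hη hπn.le
    have hjn' : ϰ₀⁻¹ ^ 2 * J p (M1 L) (M2 L) * oneArmProb d p n' ≤ ε * oneArmProb d p n' :=
      mul_le_mul_of_nonneg_right hη hπn'.le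
    have key := abs_div_sub_div_le_of_two_sided (V := μ.real (E ∩ siteToBoundary d n)) (V' := μ.real (E ∩ siteToBoundary d n'))
      (S := SEn) (S' := SEn') (T := SUn) (T' := SUn') hπn hπn' hεpos.le hε1 (hQge L hL)
      ⟨hSU1, hSU2.trans (by linarith)⟩ ⟨hSU1', hSU2'.trans (by linarith)⟩ ⟨hSE1, hSE2.trans (by linarith)⟩
      ⟨hSE1', hSE2'.trans (by linarith)⟩ h0S hSS h0S' hSS' hx1 hx2
    linarith
  have h := main n n' (by omega) hnn'
  linarith


end Summit.CriticalPhenomena.PercolationContinuityZ3.Theorems.Crossing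

end
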